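import Summits.AtomisticToContinuum.Crystallization.Theorems.ReggeStarCoercivityDefectFreeCrystallizesDevelopmentSteps1
import Summits.AtomisticToContinuum.Crystallization.Theorems.ReggeStarCoercivityDefectFreeCrystallizesDevelopmentSteps2
import Summits.AtomisticToContinuum.Crystallization.Theorems.ReggeStarCoercivityDefectFreeCrystallizesDevelopmentSteps6
import Summits.AtomisticToContinuum.Crystallization.Theorems.ReggeStarCoercivityDefectFreeCrystallizesDevelopmentVinv
import Summits.AtomisticToContinuum.Crystallization.Theorems.PalmUnimodularRigidityShellsToBarlowChartTransportAttach1

/-!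
# Swap symmetry and the attachment of transported caps (part 1/2) (port to the abstract `1/20` chart clauses)

Port of `Theorems/PalmUnimodularRigidityShellsToBarlowChartTransportAttach1.lean` (crux 9227, line
`develop-the-model-growth-descent`) to the ABSTRACT chart clauses of line `palm-good-law` of crux
stmt-AtomisticToContinuum-13603 (stub R1a4 `stub_combinatorialDevelopment`): the integer-chart hypothesis
`hch : ∀ z ∈ S, IsZChart S z …` is replaced by the section hypothesis `hch` = (pattern `fcc3Int`/`hcpInt`,
labelling `nb z` bijective onto the bonded neighbours, exact links) at every site ∧ the transfer identity for
every bonded pair; statements and proofs are otherwise verbatim (the transports `Istep, …, frameAt` and the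
pattern facts `TransportPatterns*` are reused by name).  All `[folklore]` (HalesDSP2012 §1.3).
-/

noncomputable section

namespace Summit.AtomisticToContinuum.Crystallization.Theorems.PalmGoodLaw.Development

open Literature.Geometry.DiscreteGeometry Literature.MathematicalPhysics.StatisticalMechanics
open Summit.AtomisticToContinuum.Crystallization.Theorems.ShellsToBarlowChartNegative
open Summit.AtomisticToContinuum.Crystallization.Theorems.PalmUnimodularRigidityShellsToBarlowChart

variable {S : Set (EuclideanSpace ℝ (Fin 3))} {Pc : (EuclideanSpace ℝ (Fin 3)) → Finset (Fin 3 → ℤ)}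
  {nb : (EuclideanSpace ℝ (Fin 3)) → (Fin 3 → ℤ) → (EuclideanSpace ℝ (Fin 3))}
  (hch : (∀ z ∈ S, (Pc z = fcc3Int ∨ Pc z = hcpInt) ∧
      Set.BijOn (nb z) (↑(Pc z) : Set (Fin 3 → ℤ)) {y | y ∈ S ∧ (0 < dist z y ∧ dist z y ≤ 28 / 25)} ∧
      (∀ t ∈ Pc z, ∀ t' ∈ Pc z,
        ((0 < dist (nb z t) (nb z t') ∧ dist (nb z t) (nb z t') ≤ 28 / 25) ↔ sqNormInt (t - t') = 18))) ∧
    (∀ x ∈ S, ∀ y ∈ S, (0 < dist x y ∧ dist x y ≤ 28 / 25) →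
      ∀ (z z' : EuclideanSpace ℝ (Fin 3)) (t t' u u' : Fin 3 → ℤ),
        ((t = 0 ∧ z = x) ∨ (t ∈ Pc x ∧ z = nb x t)) → ((t' = 0 ∧ z' = x) ∨ (t' ∈ Pc x ∧ z' = nb x t')) →
        ((u = 0 ∧ z = y) ∨ (u ∈ Pc y ∧ z = nb y u)) → ((u' = 0 ∧ z' = y) ∨ (u' ∈ Pc y ∧ z' = nb y u')) →
        sqNormInt (u - u') = sqNormInt (t - t')))

include hch in
/-- **Upper attachment across I, even layer**: the apex site `nb x c` of an even frame is the
neighbour of `Ix` labelled `c₊ − t₁₊` (`c₊` the apex of the transported cap): in the model,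
`(k+1, i, j)` is the upper neighbour of `(k, i+1, j)` with offset `(1, 0)`. [folklore] -/
theorem attach_I_even {x : (EuclideanSpace ℝ (Fin 3))}
    (hx : x ∈ S) {t₁ t₂ : Fin 3 → ℤ} {U : Finset (Fin 3 → ℤ)} (hU : IsFrame (Pc x) t₁ t₂ U)
    (hpar : frameParity t₁ t₂ U = 1)
    (hreg : Pc (nb x t₁) = fcc3Int ∨ Pc x = hcpInt ∨
      (-zlab Pc nb (nb x t₁) x ∈ Pc (nb x t₁) ∧ -zlab Pc nb (nb x t₁) (nb x t₂) ∈ Pc (nb x t₁))) :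
    nb (nb x t₁) (apexOf (Istep Pc nb ⟨x, t₁, t₂, U⟩).t₁ (Istep Pc nb ⟨x, t₁, t₂, U⟩).t₂
        (Istep Pc nb ⟨x, t₁, t₂, U⟩).U - (Istep Pc nb ⟨x, t₁, t₂, U⟩).t₁) = nb x (apexOf t₁ t₂ U) ∧
    zlab Pc nb (nb x t₁) (nb x (apexOf t₁ t₂ U)) =
      apexOf (Istep Pc nb ⟨x, t₁, t₂, U⟩).t₁ (Istep Pc nb ⟨x, t₁, t₂, U⟩).t₂
        (Istep Pc nb ⟨x, t₁, t₂, U⟩).U - (Istep Pc nb ⟨x, t₁, t₂, U⟩).t₁ := by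
  obtain ⟨hyS, -, -, -, -, -, -, -, -, -, -, hframe, hparI, c₁, hc₁U, -, hfilt, hbu, -, -, hfiltU⟩ :=
    Istep_spec hch hx hU hreg
  have hPx := pattern_cases hch hx
  have hPy := pattern_cases hch hyS
  obtain ⟨h12, hhex, -, -, -⟩ := id hU
  have ht₁ : t₁ ∈ Pc x := hhex (mem_hexLabels_iff.2 (Or.inl rfl))
  have ht₂ : t₂ ∈ Pc x := hhex (mem_hexLabels_iff.2 (Or.inr (Or.inl rfl)))
  obtain ⟨hcU, hcP, hc, hc1, hc2, hE⟩ := even_form_of_parity hPx hU hpar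
  set c := apexOf t₁ t₂ U with hc_def
  have hc₁ : c₁ = c := by
    have h1 := (filter_evenCap (Pc x) hPx t₁ ht₁ t₂ ht₂ c hcP h12 hhex hc hc1 hc2).1
    rw [← hE, hfilt] at h1
    exact Finset.singleton_injective h1
  rw [hc₁] at hbu hfiltU
  have hμ := zlab_spec hch hyS (nb_mem hch hx hcP).1 hbu
  -- the transported cap is even with apex `c'`
  have hpar' := hparI.trans hpar
  set a' := (Istep Pc nb ⟨x, t₁, t₂, U⟩).t₁ with ha'
  set b' := (Istep Pc nb ⟨x, t₁, t₂, U⟩).t₂ with hb'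
  set U' := (Istep Pc nb ⟨x, t₁, t₂, U⟩).U with hU'
  obtain ⟨h12', hhex', -, -, -⟩ := id hframe
  have ha'P : a' ∈ Pc (nb x t₁) := hhex' (mem_hexLabels_iff.2 (Or.inl rfl))
  have hb'P : b' ∈ Pc (nb x t₁) := hhex' (mem_hexLabels_iff.2 (Or.inr (Or.inl rfl)))
  obtain ⟨-, hc'P, hc', hc1', hc2', hE'⟩ := even_form_of_parity hPy hframe hpar'
  set c' := apexOf a' b' U' with hc'_def
  have hμeq : zlab Pc nb (nb x t₁) (nb x c) = c' - a' := by
    have h1 := (filter_evenCap (Pc (nb x t₁)) hPy a' ha'P b' hb'P c' hc'P h12' hhex' hc' hc1' hc2').2.2.1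
    rw [← hE', hfiltU] at h1
    exact Finset.singleton_injective h1
  refine ⟨?_, hμeq⟩
  rw [← hμeq]; exact hμ.2

include hch in
/-- **Upper attachment across I, odd layer**: the apex site of `Ix` is the neighbour of `x`
labelled `c + t₁`: in the model, `(k+1, i+1, j)` is an upper neighbour of `(k, i, j)`.
[folklore] -/
theorem attach_I_odd {x : (EuclideanSpace ℝ (Fin 3))}
    (hx : x ∈ S) {t₁ t₂ : Fin 3 → ℤ} {U : Finset (Fin 3 → ℤ)} (hU : IsFrame (Pc x) t₁ t₂ U)
    (hpar : frameParity t₁ t₂ U = -1)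
    (hreg : Pc (nb x t₁) = fcc3Int ∨ Pc x = hcpInt ∨
      (-zlab Pc nb (nb x t₁) x ∈ Pc (nb x t₁) ∧ -zlab Pc nb (nb x t₁) (nb x t₂) ∈ Pc (nb x t₁))) :
    nb (nb x t₁) (apexOf (Istep Pc nb ⟨x, t₁, t₂, U⟩).t₁ (Istep Pc nb ⟨x, t₁, t₂, U⟩).t₂
        (Istep Pc nb ⟨x, t₁, t₂, U⟩).U) = nb x (apexOf t₁ t₂ U + t₁) ∧
    zlab Pc nb (nb x t₁) (nb x (apexOf t₁ t₂ U + t₁)) =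
      apexOf (Istep Pc nb ⟨x, t₁, t₂, U⟩).t₁ (Istep Pc nb ⟨x, t₁, t₂, U⟩).t₂
        (Istep Pc nb ⟨x, t₁, t₂, U⟩).U := by
  obtain ⟨hyS, -, -, -, -, -, -, -, -, -, -, hframe, hparI, c₁, hc₁U, -, hfilt, hbu, -, -, hfiltU⟩ :=
    Istep_spec hch hx hU hreg
  have hPx := pattern_cases hch hx
  have hPy := pattern_cases hch hyS
  obtain ⟨h12, hhex, -, -, -⟩ := id hU
  have ht₁ : t₁ ∈ Pc x := hhex (mem_hexLabels_iff.2 (Or.inl rfl))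
  have ht₂ : t₂ ∈ Pc x := hhex (mem_hexLabels_iff.2 (Or.inr (Or.inl rfl)))
  obtain ⟨hcU, hcP, hc, hc1, hc2, hO⟩ := odd_form_of_parity hPx hU hpar
  set c := apexOf t₁ t₂ U with hc_def
  have hc₁ : c₁ = c + t₁ := by
    have h1 := (filter_oddCap (Pc x) hPx t₁ ht₁ t₂ ht₂ c hcP h12 hhex hc hc1 hc2).1
    rw [← hO, hfilt] at h1
    exact Finset.singleton_injective h1
  rw [hc₁] at hbu hfiltU
  have hμ := zlab_spec hch hyS (nb_mem hch hx hc1).1 hbu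
  have hpar' := hparI.trans hpar
  set a' := (Istep Pc nb ⟨x, t₁, t₂, U⟩).t₁ with ha'
  set b' := (Istep Pc nb ⟨x, t₁, t₂, U⟩).t₂ with hb'
  set U' := (Istep Pc nb ⟨x, t₁, t₂, U⟩).U with hU'
  obtain ⟨h12', hhex', -, -, -⟩ := id hframe
  have ha'P : a' ∈ Pc (nb x t₁) := hhex' (mem_hexLabels_iff.2 (Or.inl rfl))
  have hb'P : b' ∈ Pc (nb x t₁) := hhex' (mem_hexLabels_iff.2 (Or.inr (Or.inl rfl)))
  obtain ⟨-, hc'P, hc', hc1', hc2', hO'⟩ := odd_form_of_parity hPy hframe hpar'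
  set c' := apexOf a' b' U' with hc'_def
  have hμeq : zlab Pc nb (nb x t₁) (nb x (c + t₁)) = c' := by
    have h1 := (filter_oddCap (Pc (nb x t₁)) hPy a' ha'P b' hb'P c' hc'P h12' hhex' hc' hc1' hc2').2.2.1
    rw [← hO', hfiltU] at h1
    exact Finset.singleton_injective h1
  refine ⟨?_, hμeq⟩
  rw [← hμeq]; exact hμ.2

/-- Landing anchor of this helper file (registered on crux stmt-AtomisticToContinuum-13603 for the port of stub R1a4;
a label of the integer kissing pattern). [folklore] -/
theorem development_attach1_anchor : ![0, 3, -3] ∈ fcc3Int := by decide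

end Summit.AtomisticToContinuum.Crystallization.Theorems.PalmGoodLaw.Development

end
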